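import Summits.BirchSwinnertonDyer.Rank1Residual.GaloisImage.SakamotoN11InstanceLevelOne
import Summits.BirchSwinnertonDyer.Rank1Residual.GaloisImage.PropagatedStructureCoreRank
import Summits.BirchSwinnertonDyer.Rank1Residual.GaloisImage.PropagatedStructureUnramified
import Summits.BirchSwinnertonDyer.Rank1Residual.GaloisImage.KummerSelfDualCount
import Summits.BirchSwinnertonDyer.Rank1Residual.GaloisImage.CanonicalKolyvaginDatum
import Literature.NumberTheory.EllipticCurves.SelmerFiniteProofs
import HarnessLib

/-!
# The level-one N11 instance of Sakamoto 2024 Thm. 4.4 (1) from surj(3) with the unramifiedness,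
# the finiteness and the CORE-RANK inputs discharged down to the located gap (Lp)
# (cell `b2b-bsdres`, team n1011, row T-a3-F1; sequel of `SakamotoN11InstanceLevelOne.lean`; seat p13)

HONEST FRAMING (cell `b2b-bsdres`, run/shared/lean/b2b/bsd-rank1-residual/, verbatim in every
file): the goal of the cell is to DELETE the COMBINATION-SHAPED residual classes of the
Birch–Swinnerton-Dyer formula for ALL analytic-rank `≤ 1` elliptic curves over `ℚ` — "full BSD
formula for every rank `≤ 1` curve in class `C`" assembled STRICTLY from published theorems — so
that the rank-`≤ 1` remainder becomes exactly the CONSTRUCTION-SHAPED classes, which are TYPED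
(missing-input `Prop`s), NOT attempted. This is not "finishing BSD". Team n1011 (N10/N11, the
additive block `X4 ∧ p = 3`): research route; no claim beyond the stated classes; the label X4 and
the mark of RESIDUAL-MAP §I N11 are UNCHANGED by this file; nothing is booked. Theorems only: no
definition, no named fact is minted. CONDITIONAL on the tree's named fact
`Literature.NumberTheory.GaloisCohomology.Sakamoto2024.kolyvaginSystems_freeRankOne_zmod_three_pow`
(R. Sakamoto, JTNB 36 (2024) Thm. 4.4 (1); hypothesis `hS24`, debt of the tree) and on Tate's local
Euler–Poincaré characteristic (named fact `localEulerPoincareCharacteristic ℚ_v`, Milne *ADT* I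
Thm. 2.8; hypothesis `hEP`), both explicit in the signatures.

## What and why

`kolyvaginSystems_freeRankOne_propagatedSelmerStructure_levelOne_of_surj` (the previous file: the
level-one instance `KS₁(E[3], 𝓕_can, 𝒫(τ))` free of rank one over `𝔽₃` from surj(3) ALONE, no
tower) still carries `hS'`, `hunr` and the core rank `hCR : χ(𝓕̄_can) = 1` as binders.  All three are
theorems of the tree modulo smaller inputs, and this file performs the substitution:

* `kolyvaginSystems_freeRankOne_levelOne_of_surj_of_localInputs` — for an admissible
  `S ⊇ ∞ ∪ {3} ∪ {bad}`: `hS'`, `hunr` by n1011-p05's `not_mem_and_isUnramifiedAt_of_not_mem` /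
  `propagatedSelmerStructure_isUnramifiedOutside` (`PropagatedStructureUnramified`, p257652); the
  CORE RANK by p13's `hasCoreRank_one_propagatedSelmerStructureOne` (`PropagatedStructureCoreRank`,
  p256641) on the finite places of `S`, with ITS binders discharged: `hbd` = p05's
  `bounded_pPrimaryTorsion_localGaloisModule_rat` (p256925), `hKfin` = Silverman X.4.2 (b)
  `finite_selmerGroup_holds` through `selmerGroup_eq_selmerGroup_kummerSelmerStructure`, `hKSD` =
  p13's `natCard_selmerGroup_kummer_eq_dual` (`KummerSelfDualCount`, p256363) for a Weil pairing on
  `E[3]` (`exists_weilPairing_holds`).  What REMAINS explicit is exactly: the fact `hS24`,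
  `[Finite E[3]]`, surj(3), the `τ`-datum, the Poitou–Tate family `inv` with its four properties AND
  the injectivity of the local invariant maps (`hinj`, used by the self-duality count), Tate's local
  Euler–Poincaré characteristic at every finite place (`hEP`), **the located local gap (Lp) at `3`**
  `hLpIm : #𝓕̄_3 = 9·#E(ℚ₃)[3]` (Greenberg LNM 1716 §2; referee-1 ruling; skel T-a3-F1-CR — NOT in
  the tree), an admissible `S`, and the Kolyvagin datum with THE canonical finite–singular
  comparison maps (`HasCanonicalComparison`, row T-HCC).
* `exists_tau_kolyvaginSystems_freeRankOne_levelOne_of_surj_of_localInputs` — the `τ`-datum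
  discharged existentially: from surj(3) alone THERE IS `τ ∈ Gal(ℚ̄/ℚ(μ₃))` with `E[3]/(τ−1) ≃ 𝔽₃`
  such that, for every Kolyvagin datum on Sakamoto's primes `𝒫(τ)` with the cyclotomic transverse
  conditions and the canonical comparison maps, `KS₁(E[3], 𝓕_can)` is free of rank one over `𝔽₃`.

* `exists_kolyvaginDatum_kolyvaginSystems_freeRankOne_levelOne_of_surj_of_localInputs` — the
  Kolyvagin datum discharged as well, by n1011-p04's T-HCC construction
  (`FSComp.exists_eta_kolyvaginDatum_hasCanonicalComparison_frobeniusClassPrimes`,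
  `CanonicalKolyvaginDatum.lean`: over `ℚ` the primitive roots `η` and THE canonical
  finite–singular comparison maps on Sakamoto's primes `𝒫(τ)` exist outright): from surj(3) alone,
  the fact `hS24`, the Poitou–Tate family (+ injectivity), `hEP`, (Lp) and an admissible `S`, THERE
  ARE `τ`, `η` and a Kolyvagin datum `D` on `𝒫(τ)` with the cyclotomic transverse conditions and the
  canonical comparison maps for which `KS₁(E[3], 𝓕_can, 𝒫(τ))` is free of rank one over `𝔽₃`.

Applies on every surj(3) row of N11, in particular the EXOTIC rows (tower / (im) fail).  What is
NOT here: any discharge of `hS24`, `hEP`, (Lp) or the Poitou–Tate family; any class theorem / BSD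
consequence.

References: R. Sakamoto, JTNB 36 (2024) Def. 3.6, 3.8, Thm. 4.4 [Sakamoto2024]; J. H. Silverman,
*AEC* III.8.1, X.4.2 [SilvermanAEC2009]; J. S. Milne, *ADT* I Thm. 2.8, Lemma 3.3 [MilneADT2006];
R. Greenberg, LNM 1716 (1999) §2; B. Mazur, K. Rubin, Mem. AMS 799 (2004) Prop. 6.2.2.
-/

noncomputable section

open scoped Classical NumberField ContRepresentation
open Field NumberField IsDedekindDomain
open WeierstrassCurve Literature.NumberTheory.EllipticCurves Literature.NumberTheory.GaloisRepresentations
  Literature.NumberTheory.GaloisRepresentations.DiscreteGaloisModule Literature.NumberTheory.GaloisCohomology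

namespace Summit.BirchSwinnertonDyer.Rank1Residual.GaloisImage

variable (W : WeierstrassCurve ℚ) [W.IsElliptic]

/-! ### Level one with the unramifiedness, the finiteness and the core-rank inputs discharged -/

/-- **Level one from surj(3) with `hS'`, `hunr` AND THE CORE RANK discharged** down to their
irreducible inputs.  For an admissible `S ⊇ ∞ ∪ {3} ∪ {bad}` (`hS`, `h3S`, `hbadS`): `hS'` and
`hunr` are n1011-p05's `not_mem_and_isUnramifiedAt_of_not_mem` / `propagatedSelmerStructure_isUnramifiedOutside`;
the core rank `χ(𝓕̄_can) = 1` is p13's `hasCoreRank_one_propagatedSelmerStructureOne` on the finite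
places `T` of `S`, with its own binders discharged: `hbd` (bounded exponent of `H¹(ℚ_ℓ, E)[3^∞]`,
`ℓ ≠ 3`) by p05's `bounded_pPrimaryTorsion_localGaloisModule_rat`; `hKfin` (`Sel^{(3)}(E/ℚ)`
finite) by Silverman X.4.2 (b) `finite_selmerGroup_holds` through
`selmerGroup_eq_selmerGroup_kummerSelmerStructure`; `hKSD` (`#Sel^{(3)} = #H¹_{𝓚*}(ℚ, E[3]^D)`) by
p13's `natCard_selmerGroup_kummer_eq_dual` for a Weil pairing on `E[3]` (`exists_weilPairing_holds`).
What REMAINS explicit (nothing hidden): the fact `hS24`; `[Finite E[3]]`; surj(3) `h3`; the (H.2)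
datum `τ`, `hτμ`, `hτq` (exists: `exists_rootsOfUnityFixer_cokerSubOne_equiv_levelOne_of_surj`);
the Poitou–Tate family `inv` with `IsPerfect`, `SumLocalTermEqZero`, `UnramifiedOrthogonal`,
`SelmerComplement` and the injectivity `hinj` of the local invariant maps; Tate's local
Euler–Poincaré characteristic at every finite place `hEP` (named fact of the tree);
**the located local gap (Lp) at `3`** `hLpIm : #𝓕̄_3 = 9 · #E(ℚ₃)[3]` (Greenberg LNM 1716 §2 —
referee-1 ruling, skel T-a3-F1-CR; NOT in the tree); the admissible `S`; the Kolyvagin datum `D`,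
`η`, `hP`, `hT` and THE canonical finite–singular comparison `hD` (row T-HCC).  CONDITIONAL on
`hS24`; nothing booked; no mark changed; applies on every surj(3) row incl. EXOTIC.
[cite: Sakamoto2024, Def. 3.6 (p. 923), Def. 3.8 (p. 924) and Thm. 4.4 (p. 926)] -/
theorem kolyvaginSystems_freeRankOne_levelOne_of_surj_of_localInputs
    (hS24 : Sakamoto2024.kolyvaginSystems_freeRankOne_zmod_three_pow)
    [Finite (geomTorsion W ((3 : ℕ) : ℤ))]
    (h3 : W.HasSurjectiveModNGaloisRep ((3 : ℕ) : ℤ))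
    (τ : absoluteGaloisGroup ℚ) (hτμ : τ ∈ rootsOfUnityFixer ℚ (3 ^ (0 + 1)))
    (hτq : Nonempty (cokerSubOne (W.torsionGaloisModule (((3 : ℕ) : ℤ) ^ 0 * ((3 : ℕ) : ℤ))) τ ≃+
      ZMod (3 ^ (0 + 1))))
    (inv : LocalInvariants ℚ 3) (hperf : inv.IsPerfect) (hsum : inv.SumLocalTermEqZero)
    (hunro : inv.UnramifiedOrthogonal) (hcompl : inv.SelmerComplement)
    (hinj : ∀ v : HeightOneSpectrum (𝓞 ℚ), Function.Injective (inv (Sum.inr v)))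
    (hEP : ∀ v : HeightOneSpectrum (𝓞 ℚ), localEulerPoincareCharacteristic (v.adicCompletion ℚ))
    (hLpIm : ∀ v : HeightOneSpectrum (𝓞 ℚ), ((3 : ℕ) : 𝓞 ℚ) ∈ v.asIdeal →
      Nat.card (propagatedSelmerStructureOne W 3 (Sum.inr v)) =
        9 * Nat.card (nsmulAddMonoidHom 3 :
          (W.baseChange (v.adicCompletion ℚ)).toAffine.Point →+ _).ker)
    (S : Finset (Place ℚ)) (hS : ∀ w : InfinitePlace ℚ, (Sum.inl w : Place ℚ) ∈ S)
    (h3S : ∀ v : HeightOneSpectrum (𝓞 ℚ), ((3 : ℕ) : 𝓞 ℚ) ∈ v.asIdeal → (Sum.inr v : Place ℚ) ∈ S)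
    (hbadS : ∀ v : HeightOneSpectrum (𝓞 ℚ), ¬ W.HasGoodReductionAt v → (Sum.inr v : Place ℚ) ∈ S)
    (D : KolyvaginDatum (W.torsionGaloisModule (((3 : ℕ) : ℤ) ^ 0 * ((3 : ℕ) : ℤ))))
    (η : (q : HeightOneSpectrum (𝓞 ℚ)) → (ZMod (Ideal.absNorm q.asIdeal))ˣ)
    (hP : D.primes = frobeniusClassPrimes (W.torsionGaloisModule (((3 : ℕ) : ℤ) ^ 0 * ((3 : ℕ) : ℤ)))
      {v | (Sum.inr v : Place ℚ) ∈ S} τ (3 ^ (0 + 1)))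
    (hT : D.transverse =
      cyclotomicTransverse (W.torsionGaloisModule (((3 : ℕ) : ℤ) ^ 0 * ((3 : ℕ) : ℤ))))
    (hD : D.HasCanonicalComparison (3 ^ (0 + 1)) η) :
    KolyvaginSystem.IsFreeRankOneZMod (D.kolyvaginSystems (propagatedSelmerStructure W 3 0))
        (3 ^ (0 + 1)) ∧
      ∀ (d : Finset (HeightOneSpectrum (𝓞 ℚ))) (hd : D.IsLevel d),
        LocalInvariants.lambdaStar inv ((D.atLevel (propagatedSelmerStructure W 3 0) d).induced
          (W.torsionMulBy (((3 : ℕ) : ℤ) ^ 0) ((3 : ℕ) : ℤ))) 3 = 0 →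
        Function.Bijective fun κ : D.kolyvaginSystems (propagatedSelmerStructure W 3 0) =>
          (⟨κ.1 d, ((KolyvaginDatum.mem_kolyvaginSystems_iff D _ κ.1).mp κ.2).mem_selmerGroup
              d hd⟩ : (D.atLevel (propagatedSelmerStructure W 3 0) d).selmerGroup) := by
  haveI : Fact (Nat.Prime 3) := ⟨Nat.prime_three⟩
  -- the finite places of `S`
  let T : Finset (HeightOneSpectrum (𝓞 ℚ)) := S.preimage Sum.inr Sum.inr_injective.injOn
  have h3T : ∀ v : HeightOneSpectrum (𝓞 ℚ), ((3 : ℕ) : 𝓞 ℚ) ∈ v.asIdeal → v ∈ T :=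
    fun v hv => Finset.mem_preimage.mpr (h3S v hv)
  have hbadT : ∀ v : HeightOneSpectrum (𝓞 ℚ), ¬ W.HasGoodReductionAt v → v ∈ T :=
    fun v hv => Finset.mem_preimage.mpr (hbadS v hv)
  -- `Sel^{(3)}(E/ℚ)` is finite (Silverman X.4.2 (b))
  have hKfin : Finite (W.kummerSelmerStructure ((3 : ℕ) : ℤ)).selmerGroup := by
    rw [← selmerGroup_eq_selmerGroup_kummerSelmerStructure]
    exact W.finite_selmerGroup_holds (by norm_num)
  -- the residual self-duality count of the `3`-descent structure (Weil pairing on `E[3]`)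
  obtain ⟨e, hμ, hadd₁, hadd₂, halt, hnondeg, hgal⟩ :=
    exists_weilPairing_holds W 3 (by norm_num) (by norm_num)
  haveI := hKfin
  have hKSD := natCard_selmerGroup_kummer_eq_dual W 3 e hμ hadd₁ hadd₂ hgal halt hnondeg
    Nat.prime_three.isPrimePow (by decide) inv hinj hEP
  -- the core rank `χ(𝓕̄_can) = 1`, modulo (Lp)
  have hCR : LocalInvariants.HasCoreRank inv (propagatedSelmerStructureOne W 3) 3 1 :=
    hasCoreRank_one_propagatedSelmerStructureOne W inv hperf hsum hcompl T h3T hbadT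
      (fun v hv => bounded_pPrimaryTorsion_localGaloisModule_rat W 3 hv) hKfin hKSD hLpIm
  exact kolyvaginSystems_freeRankOne_propagatedSelmerStructure_levelOne_of_surj W hS24 h3 τ hτμ hτq
    inv hperf hsum hunro hcompl S hS
    (fun v hv => not_mem_and_isUnramifiedAt_of_not_mem W 3 0 S h3S hbadS hv)
    (propagatedSelmerStructure_isUnramifiedOutside W 3 0 S hS h3S hbadS)
    (fun v _ => hEP v) hCR D η hP hT hD

/-- **The `τ`-datum discharged existentially.**  From surj(3) ALONE there IS `τ ∈ Gal(ℚ̄/ℚ(μ₃))`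
with `E[3]/(τ − 1)E[3] ≃+ 𝔽₃` (p252385) such that — given the fact `hS24`, the Poitou–Tate family
with injective local invariant maps, Tate's local Euler–Poincaré characteristic, the located gap (Lp)
at `3` and an admissible `S` — for EVERY Kolyvagin datum on Sakamoto's primes `𝒫(τ)` with the
cyclotomic transverse conditions and THE canonical finite–singular comparison maps, the module
`KS₁(E[3], 𝓕_can, 𝒫(τ))` is free of rank one over `𝔽₃` (with the level-wise bijectivity clause).
No tower: applies on every surj(3) row incl. EXOTIC.  CONDITIONAL on `hS24`; nothing booked.
[cite: Sakamoto2024, §2 (H.2) (p. 921) and Thm. 4.4 (p. 926)] -/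
theorem exists_tau_kolyvaginSystems_freeRankOne_levelOne_of_surj_of_localInputs
    (hS24 : Sakamoto2024.kolyvaginSystems_freeRankOne_zmod_three_pow)
    [Finite (geomTorsion W ((3 : ℕ) : ℤ))]
    (h3 : W.HasSurjectiveModNGaloisRep ((3 : ℕ) : ℤ))
    (inv : LocalInvariants ℚ 3) (hperf : inv.IsPerfect) (hsum : inv.SumLocalTermEqZero)
    (hunro : inv.UnramifiedOrthogonal) (hcompl : inv.SelmerComplement)
    (hinj : ∀ v : HeightOneSpectrum (𝓞 ℚ), Function.Injective (inv (Sum.inr v)))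
    (hEP : ∀ v : HeightOneSpectrum (𝓞 ℚ), localEulerPoincareCharacteristic (v.adicCompletion ℚ))
    (hLpIm : ∀ v : HeightOneSpectrum (𝓞 ℚ), ((3 : ℕ) : 𝓞 ℚ) ∈ v.asIdeal →
      Nat.card (propagatedSelmerStructureOne W 3 (Sum.inr v)) =
        9 * Nat.card (nsmulAddMonoidHom 3 :
          (W.baseChange (v.adicCompletion ℚ)).toAffine.Point →+ _).ker)
    (S : Finset (Place ℚ)) (hS : ∀ w : InfinitePlace ℚ, (Sum.inl w : Place ℚ) ∈ S)
    (h3S : ∀ v : HeightOneSpectrum (𝓞 ℚ), ((3 : ℕ) : 𝓞 ℚ) ∈ v.asIdeal → (Sum.inr v : Place ℚ) ∈ S)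
    (hbadS : ∀ v : HeightOneSpectrum (𝓞 ℚ), ¬ W.HasGoodReductionAt v → (Sum.inr v : Place ℚ) ∈ S) :
    ∃ τ : absoluteGaloisGroup ℚ, τ ∈ rootsOfUnityFixer ℚ (3 ^ (0 + 1)) ∧
      Nonempty (cokerSubOne (W.torsionGaloisModule (((3 : ℕ) : ℤ) ^ 0 * ((3 : ℕ) : ℤ))) τ ≃+
        ZMod (3 ^ (0 + 1))) ∧
      ∀ (D : KolyvaginDatum (W.torsionGaloisModule (((3 : ℕ) : ℤ) ^ 0 * ((3 : ℕ) : ℤ))))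
        (η : (q : HeightOneSpectrum (𝓞 ℚ)) → (ZMod (Ideal.absNorm q.asIdeal))ˣ),
        D.primes = frobeniusClassPrimes (W.torsionGaloisModule (((3 : ℕ) : ℤ) ^ 0 * ((3 : ℕ) : ℤ)))
          {v | (Sum.inr v : Place ℚ) ∈ S} τ (3 ^ (0 + 1)) →
        D.transverse =
          cyclotomicTransverse (W.torsionGaloisModule (((3 : ℕ) : ℤ) ^ 0 * ((3 : ℕ) : ℤ))) →
        D.HasCanonicalComparison (3 ^ (0 + 1)) η →
        KolyvaginSystem.IsFreeRankOneZMod (D.kolyvaginSystems (propagatedSelmerStructure W 3 0))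
            (3 ^ (0 + 1)) ∧
          ∀ (d : Finset (HeightOneSpectrum (𝓞 ℚ))) (hd : D.IsLevel d),
            LocalInvariants.lambdaStar inv ((D.atLevel (propagatedSelmerStructure W 3 0) d).induced
              (W.torsionMulBy (((3 : ℕ) : ℤ) ^ 0) ((3 : ℕ) : ℤ))) 3 = 0 →
            Function.Bijective fun κ : D.kolyvaginSystems (propagatedSelmerStructure W 3 0) =>
              (⟨κ.1 d, ((KolyvaginDatum.mem_kolyvaginSystems_iff D _ κ.1).mp κ.2).mem_selmerGroup
                  d hd⟩ : (D.atLevel (propagatedSelmerStructure W 3 0) d).selmerGroup) := by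
  obtain ⟨τ, hτμ, hτq⟩ := exists_rootsOfUnityFixer_cokerSubOne_equiv_levelOne_of_surj W h3
  exact ⟨τ, hτμ, hτq, fun D η hP hT hD =>
    kolyvaginSystems_freeRankOne_levelOne_of_surj_of_localInputs W hS24 h3 τ hτμ hτq inv hperf
      hsum hunro hcompl hinj hEP hLpIm S hS h3S hbadS D η hP hT hD⟩


/-- **Everything constructible discharged: `τ`, the primitive roots `η` AND the Kolyvagin datum.**
From surj(3) ALONE — given the fact `hS24`, the Poitou–Tate family with injective local invariant
maps, Tate's local Euler–Poincaré characteristic `hEP`, the located gap (Lp) `hLpIm` and an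
admissible `S ⊇ ∞ ∪ {3} ∪ {bad}` — THERE ARE `τ ∈ Gal(ℚ̄/ℚ(μ₃))` with `E[3]/(τ − 1) ≃ 𝔽₃`
(p252385), primitive roots `η` and a Kolyvagin datum `D` on Sakamoto's primes `𝒫(τ)` with the
cyclotomic transverse conditions and THE canonical finite–singular comparison maps (n1011-p04's
T-HCC construction `FSComp.exists_eta_kolyvaginDatum_hasCanonicalComparison_frobeniusClassPrimes`,
unconditional over `ℚ`) such that `KS₁(E[3], 𝓕_can, 𝒫(τ))` is free of rank one over `𝔽₃` (with the
level-wise bijectivity clause).  Level one, no tower: every surj(3) row incl. EXOTIC.  CONDITIONAL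
on `hS24`; nothing booked; no mark changed.
[cite: Sakamoto2024, §2 (H.2) (p. 921), §4 and Thm. 4.4 (p. 926)] [cite: Rubin2011, Def. 1.9.6 and Def. 2.1.3 (pp. 14, 17)] -/
theorem exists_kolyvaginDatum_kolyvaginSystems_freeRankOne_levelOne_of_surj_of_localInputs
    (hS24 : Sakamoto2024.kolyvaginSystems_freeRankOne_zmod_three_pow)
    [Finite (geomTorsion W ((3 : ℕ) : ℤ))]
    (h3 : W.HasSurjectiveModNGaloisRep ((3 : ℕ) : ℤ))
    (inv : LocalInvariants ℚ 3) (hperf : inv.IsPerfect) (hsum : inv.SumLocalTermEqZero)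
    (hunro : inv.UnramifiedOrthogonal) (hcompl : inv.SelmerComplement)
    (hinj : ∀ v : HeightOneSpectrum (𝓞 ℚ), Function.Injective (inv (Sum.inr v)))
    (hEP : ∀ v : HeightOneSpectrum (𝓞 ℚ), localEulerPoincareCharacteristic (v.adicCompletion ℚ))
    (hLpIm : ∀ v : HeightOneSpectrum (𝓞 ℚ), ((3 : ℕ) : 𝓞 ℚ) ∈ v.asIdeal →
      Nat.card (propagatedSelmerStructureOne W 3 (Sum.inr v)) =
        9 * Nat.card (nsmulAddMonoidHom 3 :
          (W.baseChange (v.adicCompletion ℚ)).toAffine.Point →+ _).ker)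
    (S : Finset (Place ℚ)) (hS : ∀ w : InfinitePlace ℚ, (Sum.inl w : Place ℚ) ∈ S)
    (h3S : ∀ v : HeightOneSpectrum (𝓞 ℚ), ((3 : ℕ) : 𝓞 ℚ) ∈ v.asIdeal → (Sum.inr v : Place ℚ) ∈ S)
    (hbadS : ∀ v : HeightOneSpectrum (𝓞 ℚ), ¬ W.HasGoodReductionAt v → (Sum.inr v : Place ℚ) ∈ S) :
    ∃ (τ : absoluteGaloisGroup ℚ) (η : (q : HeightOneSpectrum (𝓞 ℚ)) → (ZMod (Ideal.absNorm q.asIdeal))ˣ)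
      (D : KolyvaginDatum (W.torsionGaloisModule (((3 : ℕ) : ℤ) ^ 0 * ((3 : ℕ) : ℤ)))),
      τ ∈ rootsOfUnityFixer ℚ (3 ^ (0 + 1)) ∧
      Nonempty (cokerSubOne (W.torsionGaloisModule (((3 : ℕ) : ℤ) ^ 0 * ((3 : ℕ) : ℤ))) τ ≃+
        ZMod (3 ^ (0 + 1))) ∧
      D.primes = frobeniusClassPrimes (W.torsionGaloisModule (((3 : ℕ) : ℤ) ^ 0 * ((3 : ℕ) : ℤ)))
        {v | (Sum.inr v : Place ℚ) ∈ S} τ (3 ^ (0 + 1)) ∧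
      D.transverse =
        cyclotomicTransverse (W.torsionGaloisModule (((3 : ℕ) : ℤ) ^ 0 * ((3 : ℕ) : ℤ))) ∧
      D.HasCanonicalComparison (3 ^ (0 + 1)) η ∧
      (KolyvaginSystem.IsFreeRankOneZMod (D.kolyvaginSystems (propagatedSelmerStructure W 3 0))
          (3 ^ (0 + 1)) ∧
        ∀ (d : Finset (HeightOneSpectrum (𝓞 ℚ))) (hd : D.IsLevel d),
          LocalInvariants.lambdaStar inv ((D.atLevel (propagatedSelmerStructure W 3 0) d).induced
            (W.torsionMulBy (((3 : ℕ) : ℤ) ^ 0) ((3 : ℕ) : ℤ))) 3 = 0 →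
          Function.Bijective fun κ : D.kolyvaginSystems (propagatedSelmerStructure W 3 0) =>
            (⟨κ.1 d, ((KolyvaginDatum.mem_kolyvaginSystems_iff D _ κ.1).mp κ.2).mem_selmerGroup
                d hd⟩ : (D.atLevel (propagatedSelmerStructure W 3 0) d).selmerGroup)) := by
  haveI : NeZero (3 ^ (0 + 1)) := ⟨by norm_num⟩
  obtain ⟨τ, hτμ, hτq⟩ := exists_rootsOfUnityFixer_cokerSubOne_equiv_levelOne_of_surj W h3
  obtain ⟨η, D, hP, hT, hD⟩ :=
    FSComp.exists_eta_kolyvaginDatum_hasCanonicalComparison_frobeniusClassPrimes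
      (W.torsionGaloisModule (((3 : ℕ) : ℤ) ^ 0 * ((3 : ℕ) : ℤ))) (3 ^ (0 + 1))
      {v | (Sum.inr v : Place ℚ) ∈ S} hτμ hτq
      (cyclotomicTransverse (W.torsionGaloisModule (((3 : ℕ) : ℤ) ^ 0 * ((3 : ℕ) : ℤ))))
  exact ⟨τ, η, D, hτμ, hτq, hP, hT, hD,
    kolyvaginSystems_freeRankOne_levelOne_of_surj_of_localInputs W hS24 h3 τ hτμ hτq inv hperf
      hsum hunro hcompl hinj hEP hLpIm S hS h3S hbadS D η hP hT hD⟩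

end Summit.BirchSwinnertonDyer.Rank1Residual.GaloisImage

end
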